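/-
Copyright (c) 2026. Released under the Apache 2.0 license.
NS-CLAIMS SWEEP (D-0090) — C93 `Nwankpa2025` (T3 QUICK TRANCHE, RULINGS v1.29l (4)). SKELETON (conv. (a)).
-/
import Mathlib
import Literature.Claims.NS.ClayVariants
import Literature.Analysis.FluidPDE.SobolevWholeSpace
import HarnessLib

/-!
# C93 — A. Nwankpa, «The Logic of Fluids: Coherence and Regularity in the Navier–Stokes System» (2025)

Preprints.org 202506.2259, **text of record v4** (posted 30 Oct 2025, 15 print pp.; sources/Nwankpa2025/
Preprints-202506.2259-v4/, PAGE RULE print p.N = PDF p.N+1 = pages-v4/p{N+1}.txt; "p.N" below = print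
page). v2 («The Mandate of Pressure …», census DOI …2259.v2) replaces the decisive device below by a
Bihari/Volterra argument (its Thm 6.6) — VERSION ALERT posted; this file types v4 only. Bib
`Nwankpa2025`. WHAT THIS IS NOT: not a claim about NS regularity or blow-up; not a claim
about any author beyond the typed locator. QUICK row: statement + the printed chain of Lemma 1 as
solution-level displays; nothing asserted (`def … : Prop`), records proved.

## The claim as printed
Theorem 2 (Resolution of the Clay Millennium Problem) p.11: «Let u₀ ∈ H¹(ℝ³), with ∇·u₀ = 0. Then the
corresponding Leray–Hopf weak solution u(x,t) … satisfies: 1. u ∈ C([0,∞); L²) ∩ L^∞(0,∞; L³) ∩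
C^∞((0,∞) × ℝ³), 2. the energy inequality holds for all t ≥ 0, 3. the solution is unique in the
Leray–Hopf class. Hence, the solution is globally well-posed, smooth for all time, and satisfies all
requirements of the Clay problem.» (also Thm 4.1 p.9, Thm 1 p.10, «Clay Millennium Theorem» box p.11).

## Ordered step index (Lemma 1 «Structural Rigidity of the Coherence Manifold» p.6–8 and §5 p.10–11)
* Step 1 `Step1_Energy` — (7) p.7: the energy inequality (Leray–Hopf). TRUE for the solutions typed here
  (smooth, rapidly decaying) — recorded, not contested.
* Step 2 `Step2_GN` — (8) p.7: `‖u‖_{L³} ≤ C_GN ‖u‖_{L²}^{1/2} ‖∇u‖_{L²}^{1/2}` on `ℝ³`. Standard (true).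
* Step 3 `Step3_L3Inequality` — **(10) p.7** (= (A14) Appendix G.2 p.13): «For smooth divergence-free
  solutions, multiplying the momentum equation by |u|u and integrating yields (see, e.g.,
  Lemarié-Rieusset [12]): d/dt ‖u(t)‖³_{L³} + 3ν ∫ |u||∇u|² dx ≤ 3C ‖u(t)‖²_{L³} ‖∇u(t)‖²_{L²}. The
  pressure term vanishes by incompressibility. The constant C > 0 depends only on dimension.» No
  derivation is printed (App. G.2: «rigorously justified for smooth divergence-free functions; see
  [9,12]»). Typist QC (CARD §5): the two sides scale differently under `u_λ(x,t) = λu(λx,λ²t)` (left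
  `λ²`, right `λ¹`), so a dimension-only constant is impossible unless the left side is `≤ 0` for every
  solution; and the pressure term `∫ ∇p·|u|u = −∫ p (u·∇)|u|` does not vanish for the test field `|u|u`.
* Step 3b `Step3b_A14` — (A14) App. G.2 p.13: the same inequality (constants `ν`, `C` instead of `3ν`,
  `3C`) asserted for smooth divergence-free compactly supported FIELDS `u^ε` with no equation imposed
  (App. G.1) — the print's own second grain (observation: typist-4 g2); kernel handle `u = e^{λt}w`.
* Step 4 `Step4_Division` — (11) p.7: with `y = ‖u‖_{L³}`, `d(y³)/dt = 3y² dy/dt`, so (10) gives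
  `dy/dt ≤ C ‖∇u‖²_{L²}` (where `y > 0`). Calculus, given (10).
* Step 5 `Step5_UniformL3` — (12)–(13) p.7–8: `sup_{t<T} ‖u(t)‖_{L³} ≤ ‖u₀‖_{L³} + Cν⁻¹‖u₀‖²_{L²}`.
* Step 6 `Step6_ESSBridge` — Cor. 1 p.8 + Lemma 2 p.8 + Thm 4.1 p.9 + Thm 1 p.10 + Thm 2 p.11: the uniform
  `L³` bound ⇒ (Escauriaza–Seregin–Šverák [7]) smoothness for `t > 0`, uniqueness, global solution.
`claim_of_steps : Step5 → Step6 → ClaimedTheorem`; Steps 1–4 are the printed DERIVATION of Step 5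
((7)+(10)+(11) integrate to (12)–(13)) and are typed as free-standing displays so that the refuter can
name the first false one; they are not re-derived in Lean (no idle binders).

## Clay delta (reference `ClayVariants`)
Nearest (A). Δ1 `ℝ³` = · Δ2 (1)–(3) = · Δ3 `f ≡ 0` = · Δ4 data `H¹` (Thm 2) / `L² ∩ L³` (Lemma 1) ⊋ the
Clay class (4) — STRONGER claim (good direction); typed at the Clay data class `HasRapidSpatialDecay`
(special case) · **Δ5/Δ6**: the printed conclusion is `C^∞((0,∞) × ℝ³)` + `C([0,∞);L²)` — smoothness on
the OPEN half-space; (A) asks `p, u ∈ C^∞(ℝ³ × [0,∞))` and bounded energy (7): recorded as `ClayDelta`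
(`clay_of_claimed_of_delta`); bounded energy is item 2 of Thm 2 (energy inequality) — typed in.

## Kill / certificate kit
At the solutions grain (10) none (QUICK): a solution-level a-priori inequality with no printed proof; the
typist's scaling check and the pressure remark are paper-level (CARD §5). At the functions grain (A14)
`Step3b_A14` is kernel-refutable: `u(t,x) = e^{λt} w(x)` with `w` a smooth divergence-free bump gives
`d/dt‖u‖³_{L³} = 3λ e^{3λt}‖w‖³_{L³}` against a `λ`-free right side at `t = 0` (refuter's filing; not
drafted here). `clay_of_claimed_of_delta` PROVED.
-/

open scoped ContDiff
open Set MeasureTheory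

namespace Literature.Claims.NS.Nwankpa2025

open Literature.Analysis.FluidPDE Literature.Claims.NS.ClayVariants

/-- `ℝ³` (plumbing). [folklore] -/
abbrev E3 := EuclideanSpace ℝ (Fin 3)

/-! ## Norm functionals of a time-dependent field (print p.7) -/

/-- `‖u(t)‖²_{L²}`. [cite: Nwankpa2025, (7) p.7] -/
noncomputable def l2sq (u : ℝ → E3 → E3) (t : ℝ) : ℝ := ∫ x, ‖u t x‖ ^ 2

/-- `‖u(t)‖³_{L³}`. [cite: Nwankpa2025, (9)–(10) p.7] -/
noncomputable def l3cube (u : ℝ → E3 → E3) (t : ℝ) : ℝ := ∫ x, ‖u t x‖ ^ 3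

/-- `‖∇u(t)‖²_{L²}` (Frobenius/operator norm of the Fréchet derivative; constants absorb the choice).
[cite: Nwankpa2025, (7) p.7] -/
noncomputable def gradsq (u : ℝ → E3 → E3) (t : ℝ) : ℝ := ∫ x, ‖fderiv ℝ (u t) x‖ ^ 2

/-- `∫ |u||∇u|² dx` (the dissipative term of (10)). [cite: Nwankpa2025, (10) p.7] -/
noncomputable def mixed (u : ℝ → E3 → E3) (t : ℝ) : ℝ := ∫ x, ‖u t x‖ * ‖fderiv ℝ (u t) x‖ ^ 2

/-- The solutions the displays are typed on: a global smooth solution of (1)–(3) on `ℝ³ × [0,∞)` with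
`f ≡ 0` from a smooth divergence-free rapidly decaying datum (the Clay data class — a SPECIAL CASE of the
paper's `u₀ ∈ L² ∩ L³` / `H¹` Leray–Hopf setting; the paper states (10) «for smooth divergence-free
solutions» first, p.7). [cite: Nwankpa2025, Lemma 1 p.6; (10) p.7] -/
structure SmoothGlobalSolution (ν : ℝ) (u₀ : E3 → E3) (u : ℝ → E3 → E3) (p : ℝ → E3 → ℝ) : Prop where
  data_smooth : ContDiff ℝ ∞ u₀
  data_divFree : NSWave0.IsDivFree u₀
  data_decay : HasRapidSpatialDecay u₀
  smooth_u : IsSmoothOnHalfSpace u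
  smooth_p : IsSmoothOnHalfSpace p
  solves : IsNavierStokesSolution ν 0 u₀ u p

/-! ## The claimed statement -/

/-- **Theorem 2 (Resolution of the Clay Millennium Problem)** p.11, typed at the Clay data class (special
case of the printed `u₀ ∈ H¹`): for every `ν > 0` and every smooth divergence-free rapidly decaying `u₀`
there are `u`, `p` solving (1)–(3) on `ℝ³ × [0,∞)` with `u(0) = u₀`, smooth on the OPEN half-space
`(0,∞) × ℝ³` (item 1: `C^∞((0,∞)×ℝ³)`), with the energy inequality (item 2) and `u ∈ L^∞(0,∞;L³)`
(item 1). Continuity into `L²` at `t = 0` and uniqueness (item 3) are not typed (weaker).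
[cite: Nwankpa2025, Thm 2 p.11; Thm 4.1 p.9; Thm 1 p.10]
[claim: Nwankpa2025, status: under-review] -/
def ClaimedTheorem : Prop :=
  ∀ ν : ℝ, 0 < ν → ∀ u₀ : E3 → E3, ContDiff ℝ ∞ u₀ → NSWave0.IsDivFree u₀ → HasRapidSpatialDecay u₀ →
    ∃ (u : ℝ → E3 → E3) (p : ℝ → E3 → ℝ),
      ContDiffOn ℝ ∞ (Function.uncurry u) (Ioi (0 : ℝ) ×ˢ univ) ∧
      ContDiffOn ℝ ∞ (Function.uncurry p) (Ioi (0 : ℝ) ×ˢ univ) ∧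
      IsNavierStokesSolution ν 0 u₀ u p ∧
      (∀ t : ℝ, 0 ≤ t → l2sq u t / 2 + ν * ∫ s in (0 : ℝ)..t, gradsq u s ≤ l2sq u 0 / 2) ∧
      (∃ M : ℝ, ∀ t : ℝ, 0 ≤ t → l3cube u t ≤ M)

/-! ## The steps (Lemma 1 p.6–8; §5 p.10–11) -/

/-- **Step 1 — (7) p.7, energy inequality**: `½‖u(t)‖²₂ + ν∫₀ᵗ‖∇u‖²₂ ≤ ½‖u₀‖²₂` for the solutions typed
here. [cite: Nwankpa2025, (7) p.7] -/
def Step1_Energy : Prop :=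
  ∀ (ν : ℝ) (u₀ : E3 → E3) (u : ℝ → E3 → E3) (p : ℝ → E3 → ℝ), 0 < ν → SmoothGlobalSolution ν u₀ u p →
    ∀ t : ℝ, 0 ≤ t → l2sq u t / 2 + ν * ∫ s in (0 : ℝ)..t, gradsq u s ≤ l2sq u 0 / 2

/-- **Step 2 — (8) p.7, Gagliardo–Nirenberg on `ℝ³`**: `‖v‖_{L³} ≤ C_GN ‖v‖_{L²}^{1/2} ‖∇v‖_{L²}^{1/2}`
for smooth rapidly decaying `v` (cubed: `‖v‖³₃ ≤ C³ ‖v‖₂^{3/2} ‖∇v‖₂^{3/2}`).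
[cite: Nwankpa2025, (8) p.7] -/
def Step2_GN : Prop :=
  ∃ C : ℝ, 0 < C ∧ ∀ v : E3 → E3, ContDiff ℝ ∞ v → HasRapidSpatialDecay v →
    ∫ x, ‖v x‖ ^ 3 ≤ C ^ 3 * (∫ x, ‖v x‖ ^ 2) ^ (3 / 4 : ℝ) * (∫ x, ‖fderiv ℝ v x‖ ^ 2) ^ (3 / 4 : ℝ)

/-- **Step 3 — (10) p.7 (= (A14) App. G.2 p.13), the `L³` evolution inequality** AS PRINTED: there is a
dimension-only constant `C > 0` such that for every smooth divergence-free solution and every `t > 0` at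
which `s ↦ ‖u(s)‖³_{L³}` is differentiable with derivative `D`,
`D + 3ν ∫|u||∇u|² ≤ 3C ‖u(t)‖²_{L³} ‖∇u(t)‖²_{L²}` («The pressure term vanishes by incompressibility»; no
derivation printed). [cite: Nwankpa2025, (10) p.7; (A14) p.13] -/
def Step3_L3Inequality : Prop :=
  ∃ C : ℝ, 0 < C ∧ ∀ (ν : ℝ) (u₀ : E3 → E3) (u : ℝ → E3 → E3) (p : ℝ → E3 → ℝ), 0 < ν →
    SmoothGlobalSolution ν u₀ u p → ∀ t : ℝ, 0 < t → ∀ D : ℝ, HasDerivAt (l3cube u) D t →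
      D + 3 * ν * mixed u t ≤ 3 * C * (l3cube u t) ^ (2 / 3 : ℝ) * gradsq u t

/-- **Step 3b — the same inequality at the print's FUNCTIONS grain, (A14) Appendix G.2 p.13** («For each
smooth u^ε, multiply the Navier–Stokes equations by |u^ε|u^ε and integrate over ℝ³ to obtain:
d/dt ‖u^ε(t)‖³_{L³} + ν ∫ |u^ε||∇u^ε|² dx ≤ C ‖u^ε(t)‖²_{L³} ‖∇u^ε(t)‖²_{L²}. (A14) This estimate is
rigorously justified for smooth divergence-free functions; see [9,12]»), where App. G.1 p.13 takes the
`u^ε ∈ C_c^∞(ℝ³ × (0,T))` smooth, divergence-free («mollified approximations») and imposes NO equation on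
them: typed for every jointly smooth time-dependent field, divergence-free and compactly supported in
space at each time, at every `t` where `s ↦ ‖u(s)‖³_{L³}` is differentiable. (Grain observation: typist-4
g2, STATUS 01:56:24Z — the kernel handle `u(t,x) = e^{λt} w(x)` lives here.)
[cite: Nwankpa2025, (A14) App. G.2 p.13; App. G.1 p.13] -/
def Step3b_A14 : Prop :=
  ∃ C : ℝ, 0 < C ∧ ∀ (ν : ℝ) (u : ℝ → E3 → E3), 0 < ν → ContDiff ℝ ∞ (Function.uncurry u) →
    (∀ t, NSWave0.IsDivFree (u t)) → (∀ t, HasCompactSupport (u t)) →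
      ∀ t D : ℝ, HasDerivAt (l3cube u) D t →
        D + ν * mixed u t ≤ C * (l3cube u t) ^ (2 / 3 : ℝ) * gradsq u t

/-- **Step 4 — (11) p.7**: with `y(t) = ‖u(t)‖_{L³}`, «dividing (10) by 3y²(t) (where y(t) > 0) gives
dy/dt ≤ C‖∇u(t)‖²_{L²}» — typed as printed, for the same constant shape.
[cite: Nwankpa2025, (11) p.7] -/
def Step4_Division : Prop :=
  ∃ C : ℝ, 0 < C ∧ ∀ (ν : ℝ) (u₀ : E3 → E3) (u : ℝ → E3 → E3) (p : ℝ → E3 → ℝ), 0 < ν →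
    SmoothGlobalSolution ν u₀ u p → ∀ t : ℝ, 0 < t → 0 < l3cube u t →
      ∀ D : ℝ, HasDerivAt (fun s => (l3cube u s) ^ (1 / 3 : ℝ)) D t → D ≤ C * gradsq u t

/-- **Step 5 — (12)–(13) p.7–8, the uniform `L³` bound** («Key Result: Persistence of Coherence»):
`sup_{t} ‖u(t)‖_{L³} ≤ ‖u₀‖_{L³} + Cν⁻¹‖u₀‖²_{L²}`.
[cite: Nwankpa2025, (12)–(13) p.7–8; Cor. 1 p.8] -/
def Step5_UniformL3 : Prop :=
  ∃ C : ℝ, 0 < C ∧ ∀ (ν : ℝ) (u₀ : E3 → E3) (u : ℝ → E3 → E3) (p : ℝ → E3 → ℝ), 0 < ν →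
    SmoothGlobalSolution ν u₀ u p → ∀ t : ℝ, 0 ≤ t →
      (l3cube u t) ^ (1 / 3 : ℝ) ≤ (l3cube u 0) ^ (1 / 3 : ℝ) + C * ν⁻¹ * l2sq u 0

/-- **Step 6 — the ESS bridge** (Cor. 1 p.8 «satisfying the hypothesis of the Escauriaza–Seregin–Šverák
theorem [7]»; Lemma 2 p.8; Thm 4.1 p.9; Thm 1 p.10; Thm 2 p.11): the uniform `L³` a-priori bound for
smooth solutions yields the claimed global statement (local existence + continuation + ESS are invoked,
not printed). [cite: Nwankpa2025, Cor. 1 p.8; Thm 2 p.11] -/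
def Step6_ESSBridge : Prop := Step5_UniformL3 → ClaimedTheorem

/-- The chain as printed (Steps 1–4 are the printed derivation of Step 5; see the module docstring).
[cite: Nwankpa2025, Lemma 1 p.6–8; Thm 2 p.11] -/
theorem claim_of_steps (h5 : Step5_UniformL3) (h6 : Step6_ESSBridge) : ClaimedTheorem := h6 h5

/-! ## Clay delta (Δ5/Δ6: smoothness on the closed half-space, bounded energy) -/

/-- **The unprinted gap to (A)**: whenever the claimed objects exist, the solution is smooth on the
CLOSED half-space `ℝ³ × [0,∞)` (u and p) and has bounded energy — (A) (6)–(7); Thm 2 prints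
`C^∞((0,∞)×ℝ³)` only. [cite: Nwankpa2025, Thm 2 item 1 p.11] -/
def ClayDelta : Prop :=
  ∀ (ν : ℝ) (u₀ : E3 → E3) (u : ℝ → E3 → E3) (p : ℝ → E3 → ℝ), 0 < ν →
    ContDiff ℝ ∞ u₀ → NSWave0.IsDivFree u₀ → HasRapidSpatialDecay u₀ →
    ContDiffOn ℝ ∞ (Function.uncurry u) (Ioi (0 : ℝ) ×ˢ univ) → IsNavierStokesSolution ν 0 u₀ u p →
      IsSmoothOnHalfSpace u ∧ IsSmoothOnHalfSpace p ∧ HasBoundedEnergy u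

/-- Transfer: the claim plus the delta give Clay (A) `clayR3.Regularity`.
[cite: Nwankpa2025, Thm 2 p.11] -/
theorem clay_of_claimed_of_delta (h : ClaimedTheorem) (hΔ : ClayDelta) : clayR3.Regularity := by
  intro ν hν u₀ hs hdiv hdec
  obtain ⟨u, p, hu, -, hsol, -, -⟩ := h ν hν u₀ hs hdiv hdec
  obtain ⟨hu', hp', hE⟩ := hΔ ν u₀ u p hν hs hdiv hdec hu hsol
  exact ⟨u, p, hu', hp', hsol, hE⟩

/-! ## Kernel certificate for Step 2 — the Gagliardo–Nirenberg display (8) p.7 (APPEND-ONLY, 2026-08-27)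

`theorem step2_GN_holds : Step2_GN` — the display (8) is a TRUE classical inequality on `ℝ³`; it is
UPSTREAM of the adjudicated locator `Step3b_A14` (#90: Steps 1–2 true, first failing step = (A14)/(10)),
so this certificate changes no verdict, locator, class or statement. Proof (Nirenberg 1959 / Evans PDE
§5.6.1 Thm 1 route): the whole-space Gagliardo–Nirenberg–Sobolev inequality `‖v‖_{L⁶} ≤ K‖Dv‖_{L²}` for
`C¹ ∩ L²` fields WITHOUT compact support (tree: `Literature.Analysis.FluidPDE.eLpNorm_six_le_eLpNorm_fderiv_two`,
`K = SNormLESNormFDerivOfEqConst`), in integral form, and the two Cauchy–Schwarz interpolations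
`∫‖v‖⁴ ≤ √∫‖v‖² √∫‖v‖⁶`, `∫‖v‖³ ≤ √∫‖v‖² √∫‖v‖⁴`, whence `∫‖v‖³ ≤ K^{3/2} (∫‖v‖²)^{3/4} (∫‖Dv‖²)^{3/4}`;
the integrability of `‖v‖^p` and `‖Dv‖²` comes from the rapid decay (4) by `(1+‖x‖)^{-4}`-domination
(Mathlib `integrable_one_add_norm`). Constant of record: `C = √K + 1`. -/

section Step2Certificate

/-- Order-0 decay: `‖v x‖ ≤ C (1+‖x‖)^{-4}` with `C ≥ 0`. (Proof device.) [folklore] -/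
private theorem exists_norm_le_of_decay {v : E3 → E3} (hd : HasRapidSpatialDecay v) :
    ∃ C : ℝ, 0 ≤ C ∧ ∀ x, ‖v x‖ ≤ C * (1 + ‖x‖) ^ (-(4 : ℝ)) := by
  obtain ⟨C, hC⟩ := hd 0 4
  have hC0 : 0 ≤ C := le_trans (by positivity) (hC 0)
  refine ⟨C, hC0, fun x => ?_⟩
  have hx : 0 < 1 + ‖x‖ := by positivity
  have h := hC x
  rw [norm_iteratedFDeriv_zero] at h
  rw [show (-(4 : ℝ)) = -((4 : ℕ) : ℝ) by norm_num, Real.rpow_neg hx.le, Real.rpow_natCast,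
    ← div_eq_mul_inv, le_div_iff₀ (by positivity), mul_comm]
  exact h

/-- `(1+‖x‖)^{-4}` is integrable on `ℝ³` (`4 > 3 = dim`). (Proof device.) [folklore] -/
private theorem integrable_weight_four :
    Integrable (fun x : E3 => (1 + ‖x‖) ^ (-(4 : ℝ))) volume := by
  have := integrable_one_add_norm (E := E3) (μ := volume) (r := 4)
    (by norm_num [finrank_euclideanSpace])
  simpa using this

/-- Rapid decay ⇒ `‖v‖^p ∈ L¹(ℝ³)` for every `p ≥ 1`. (Proof device.) [folklore] -/
private theorem integrable_norm_pow_of_decay {v : E3 → E3} (hv : Continuous v)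
    (hd : HasRapidSpatialDecay v) (p : ℕ) (hp : 1 ≤ p) :
    Integrable (fun x => ‖v x‖ ^ p) volume := by
  obtain ⟨C, hC0, hC⟩ := exists_norm_le_of_decay hd
  refine Integrable.mono' (integrable_weight_four.const_mul (C ^ p))
    ((hv.norm.pow p).aestronglyMeasurable) (ae_of_all _ fun x => ?_)
  rw [Real.norm_eq_abs, abs_of_nonneg (by positivity)]
  have hw0 : 0 ≤ (1 + ‖x‖) ^ (-(4 : ℝ)) := by positivity
  have hw1 : (1 + ‖x‖) ^ (-(4 : ℝ)) ≤ 1 :=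
    Real.rpow_le_one_of_one_le_of_nonpos (by linarith [norm_nonneg x]) (by norm_num)
  have h1 : ‖v x‖ ≤ C := (hC x).trans (mul_le_of_le_one_right hC0 hw1)
  obtain ⟨q, rfl⟩ : ∃ q, p = q + 1 := ⟨p - 1, by omega⟩
  calc ‖v x‖ ^ (q + 1) = ‖v x‖ ^ q * ‖v x‖ := pow_succ _ _
    _ ≤ C ^ q * (C * (1 + ‖x‖) ^ (-(4 : ℝ))) :=
        mul_le_mul (pow_le_pow_left₀ (norm_nonneg _) h1 q) (hC x) (norm_nonneg _) (by positivity)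
    _ = C ^ (q + 1) * (1 + ‖x‖) ^ (-(4 : ℝ)) := by ring

/-- Rapid decay ⇒ `‖Dv‖² ∈ L¹(ℝ³)` for `C¹` fields. (Proof device.) [folklore] -/
private theorem integrable_norm_fderiv_sq_of_decay {v : E3 → E3} (hv : ContDiff ℝ 1 v)
    (hd : HasRapidSpatialDecay v) : Integrable (fun x => ‖fderiv ℝ v x‖ ^ 2) volume := by
  obtain ⟨C, hC⟩ := hd 1 2
  have hC0 : 0 ≤ C := le_trans (by positivity) (hC 0)
  have hpt : ∀ x, ‖fderiv ℝ v x‖ ≤ C * (1 + ‖x‖) ^ (-(2 : ℝ)) := by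
    intro x
    have hx : 0 < 1 + ‖x‖ := by positivity
    have h := hC x
    rw [norm_iteratedFDeriv_one] at h
    rw [show (-(2 : ℝ)) = -((2 : ℕ) : ℝ) by norm_num, Real.rpow_neg hx.le, Real.rpow_natCast,
      ← div_eq_mul_inv, le_div_iff₀ (by positivity), mul_comm]
    exact h
  refine Integrable.mono' (integrable_weight_four.const_mul (C ^ 2))
    (((hv.continuous_fderiv one_ne_zero).norm.pow 2).aestronglyMeasurable) (ae_of_all _ fun x => ?_)
  rw [Real.norm_eq_abs, abs_of_nonneg (by positivity)]
  have hx : 0 ≤ 1 + ‖x‖ := by positivity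
  calc ‖fderiv ℝ v x‖ ^ 2 ≤ (C * (1 + ‖x‖) ^ (-(2 : ℝ))) ^ 2 :=
        pow_le_pow_left₀ (norm_nonneg _) (hpt x) 2
    _ = C ^ 2 * (1 + ‖x‖) ^ (-(4 : ℝ)) := by
        rw [mul_pow, ← Real.rpow_natCast ((1 + ‖x‖) ^ (-(2 : ℝ))) 2, ← Real.rpow_mul hx]
        norm_num

/-- Cauchy–Schwarz interpolation of `L^p` norms of a continuous rapidly decaying field:
`∫‖v‖^{a+b} ≤ √(∫‖v‖^{2a}) √(∫‖v‖^{2b})` (`a, b ≥ 1`). (Proof device.) [folklore] -/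
private theorem integral_norm_pow_add_le {v : E3 → E3} (hv : Continuous v)
    (hd : HasRapidSpatialDecay v) (a b : ℕ) (ha : 1 ≤ a) (hb : 1 ≤ b) :
    ∫ x, ‖v x‖ ^ (a + b) ≤
      Real.sqrt (∫ x, ‖v x‖ ^ (2 * a)) * Real.sqrt (∫ x, ‖v x‖ ^ (2 * b)) := by
  have hmem : ∀ c : ℕ, 1 ≤ c → MemLp (fun x => ‖v x‖ ^ c) (ENNReal.ofReal 2) volume := by
    intro c hc
    rw [ENNReal.ofReal_ofNat]
    refine (memLp_two_iff_integrable_sq_norm ((hv.norm.pow c).aestronglyMeasurable)).2 ?_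
    refine (integrable_norm_pow_of_decay hv hd (2 * c) (by omega)).congr (ae_of_all _ fun x => ?_)
    show ‖v x‖ ^ (2 * c) = ‖‖v x‖ ^ c‖ ^ 2
    rw [norm_pow, norm_norm, ← pow_mul, mul_comm]
  have h := integral_mul_norm_le_Lp_mul_Lq Real.HolderConjugate.two_two (hmem a ha) (hmem b hb)
  have e1 : ∫ x, ‖‖v x‖ ^ a‖ * ‖‖v x‖ ^ b‖ = ∫ x, ‖v x‖ ^ (a + b) :=
    integral_congr_ae (ae_of_all _ fun x => by
      show ‖‖v x‖ ^ a‖ * ‖‖v x‖ ^ b‖ = ‖v x‖ ^ (a + b)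
      rw [norm_pow, norm_norm, norm_pow, norm_norm, pow_add])
  have e2 : ∀ c : ℕ, ∫ x, ‖‖v x‖ ^ c‖ ^ (2 : ℝ) = ∫ x, ‖v x‖ ^ (2 * c) := fun c =>
    integral_congr_ae (ae_of_all _ fun x => by
      show ‖‖v x‖ ^ c‖ ^ (2 : ℝ) = ‖v x‖ ^ (2 * c)
      rw [norm_pow, norm_norm, Real.rpow_two, ← pow_mul, mul_comm])
  rw [e1, e2 a, e2 b, ← Real.sqrt_eq_rpow, ← Real.sqrt_eq_rpow] at h
  exact h

/-- The whole-space Sobolev inequality `H¹ ⊂ L⁶` in integral form for a `C¹` rapidly decaying field: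
`∫‖v‖⁶ ≤ (K √∫‖Dv‖²)⁶`, `K = SNormLESNormFDerivOfEqConst` (tree GNS
`eLpNorm_six_le_eLpNorm_fderiv_two`, no compact support). (Proof device.) [folklore] -/
private theorem integral_norm_pow_six_le_of_decay {v : E3 → E3} (hv : ContDiff ℝ 1 v)
    (hd : HasRapidSpatialDecay v) :
    ∫ x, ‖v x‖ ^ 6 ≤
      ((SNormLESNormFDerivOfEqConst E3 (volume : Measure E3) 2 : ℝ) *
        Real.sqrt (∫ x, ‖fderiv ℝ v x‖ ^ 2)) ^ 6 := by
  set K₀ : NNReal := SNormLESNormFDerivOfEqConst E3 (volume : Measure E3) 2 with hK₀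
  have hvc : Continuous v := hv.continuous
  have hDc : Continuous (fderiv ℝ v) := hv.continuous_fderiv one_ne_zero
  have h2 : Integrable (fun x => ‖v x‖ ^ 2) volume := integrable_norm_pow_of_decay hvc hd 2 (by norm_num)
  have h6 : Integrable (fun x => ‖v x‖ ^ 6) volume := integrable_norm_pow_of_decay hvc hd 6 (by norm_num)
  have hD : Integrable (fun x => ‖fderiv ℝ v x‖ ^ 2) volume := integrable_norm_fderiv_sq_of_decay hv hd
  have hm2 : MemLp v 2 volume := (memLp_two_iff_integrable_sq_norm hvc.aestronglyMeasurable).2 h2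
  have hm6 : MemLp v 6 volume := by
    refine (integrable_norm_rpow_iff hvc.aestronglyMeasurable (by norm_num) (by norm_num)).1 ?_
    refine h6.congr (ae_of_all _ fun x => ?_)
    simp only [ENNReal.toReal_ofNat]
    rw [show (6 : ℝ) = ((6 : ℕ) : ℝ) by norm_num, Real.rpow_natCast]
  have hmD : MemLp (fderiv ℝ v) 2 volume :=
    (memLp_two_iff_integrable_sq_norm hDc.aestronglyMeasurable).2 hD
  have hsob := eLpNorm_six_le_eLpNorm_fderiv_two (volume : Measure E3) (F := E3)
    finrank_euclideanSpace_fin hv hm2.eLpNorm_lt_top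
  set I6 : ℝ := ∫ x, ‖v x‖ ^ 6 with hI6
  set B : ℝ := ∫ x, ‖fderiv ℝ v x‖ ^ 2 with hB
  have hI60 : 0 ≤ I6 := integral_nonneg fun x => by positivity
  have hB0 : 0 ≤ B := integral_nonneg fun x => by positivity
  have e6 : eLpNorm v 6 volume = ENNReal.ofReal (I6 ^ ((6 : ℝ)⁻¹)) := by
    rw [MemLp.eLpNorm_eq_integral_rpow_norm (by norm_num) (by norm_num) hm6, ENNReal.toReal_ofNat]
    have hint : ∫ x, ‖v x‖ ^ (6 : ℝ) = I6 := integral_congr_ae (ae_of_all _ fun x => by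
      show ‖v x‖ ^ (6 : ℝ) = ‖v x‖ ^ 6
      rw [show (6 : ℝ) = ((6 : ℕ) : ℝ) by norm_num, Real.rpow_natCast])
    simp only [hint]
  have e2 : eLpNorm (fderiv ℝ v) 2 volume = ENNReal.ofReal (Real.sqrt B) := by
    rw [MemLp.eLpNorm_eq_integral_rpow_norm (by norm_num) (by norm_num) hmD, ENNReal.toReal_ofNat]
    have hint : ∫ x, ‖fderiv ℝ v x‖ ^ (2 : ℝ) = B := integral_congr_ae (ae_of_all _ fun x => by
      show ‖fderiv ℝ v x‖ ^ (2 : ℝ) = ‖fderiv ℝ v x‖ ^ 2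
      rw [Real.rpow_two])
    rw [hint, Real.sqrt_eq_rpow, one_div]
  rw [e6, e2, ← ENNReal.ofReal_coe_nnreal, ← ENNReal.ofReal_mul (NNReal.coe_nonneg _)] at hsob
  have hle : I6 ^ ((6 : ℝ)⁻¹) ≤ (K₀ : ℝ) * Real.sqrt B :=
    (ENNReal.ofReal_le_ofReal_iff (by positivity)).1 hsob
  have h := pow_le_pow_left₀ (Real.rpow_nonneg hI60 _) hle 6
  have hid : (I6 ^ ((6 : ℝ)⁻¹)) ^ (6 : ℕ) = I6 := by
    rw [← Real.rpow_natCast, ← Real.rpow_mul hI60]; norm_num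
  rwa [hid] at h

/-- The real-variable count: from `I4 ≤ √A √I6`, `I3 ≤ √A √I4`, `I6 ≤ (K√B)⁶` conclude
`I3 ≤ (√K+1)³ A^{3/4} B^{3/4}`. (Proof device.) [folklore] -/
private theorem gn_count {A B I3 I4 I6 K : ℝ} (hA : 0 ≤ A) (hB : 0 ≤ B) (hK : 0 ≤ K)
    (h4 : I4 ≤ Real.sqrt A * Real.sqrt I6) (h3 : I3 ≤ Real.sqrt A * Real.sqrt I4)
    (h6 : I6 ≤ (K * Real.sqrt B) ^ 6) :
    I3 ≤ (Real.sqrt K + 1) ^ 3 * A ^ (3 / 4 : ℝ) * B ^ (3 / 4 : ℝ) := by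
  -- fourth roots `a, b` and the square root `k`
  set a := Real.sqrt (Real.sqrt A) with ha
  set b := Real.sqrt (Real.sqrt B) with hb
  set k := Real.sqrt K with hk
  have ha0 : 0 ≤ a := Real.sqrt_nonneg _
  have hb0 : 0 ≤ b := Real.sqrt_nonneg _
  have hk0 : 0 ≤ k := Real.sqrt_nonneg _
  have hsA : Real.sqrt A = a ^ 2 := (Real.sq_sqrt (Real.sqrt_nonneg A)).symm
  have hsB : Real.sqrt B = b ^ 2 := (Real.sq_sqrt (Real.sqrt_nonneg B)).symm
  have hAa : A = a ^ 4 := by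
    rw [show a ^ 4 = (a ^ 2) ^ 2 by ring, ← hsA, Real.sq_sqrt hA]
  have hBb : B = b ^ 4 := by
    rw [show b ^ 4 = (b ^ 2) ^ 2 by ring, ← hsB, Real.sq_sqrt hB]
  have hKk : K = k ^ 2 := (Real.sq_sqrt hK).symm
  have hA34 : A ^ (3 / 4 : ℝ) = a ^ 3 := by
    rw [hAa, ← Real.rpow_natCast a 4, ← Real.rpow_mul ha0,
      show ((4 : ℕ) : ℝ) * (3 / 4 : ℝ) = ((3 : ℕ) : ℝ) by norm_num, Real.rpow_natCast]
  have hB34 : B ^ (3 / 4 : ℝ) = b ^ 3 := by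
    rw [hBb, ← Real.rpow_natCast b 4, ← Real.rpow_mul hb0,
      show ((4 : ℕ) : ℝ) * (3 / 4 : ℝ) = ((3 : ℕ) : ℝ) by norm_num, Real.rpow_natCast]
  -- `√I6 ≤ (k b)⁶`
  have h6' : I6 ≤ ((k * b) ^ 6) ^ 2 := by
    calc I6 ≤ (K * Real.sqrt B) ^ 6 := h6
      _ = ((k * b) ^ 6) ^ 2 := by rw [hKk, hsB]; ring
  have hs6 : Real.sqrt I6 ≤ (k * b) ^ 6 := by
    have := Real.sqrt_le_sqrt h6'
    rwa [Real.sqrt_sq (by positivity)] at this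
  -- `√I4 ≤ a (k b)³`
  have h4' : I4 ≤ (a * (k * b) ^ 3) ^ 2 := by
    calc I4 ≤ Real.sqrt A * Real.sqrt I6 := h4
      _ ≤ a ^ 2 * (k * b) ^ 6 := by
          rw [hsA]; exact mul_le_mul_of_nonneg_left hs6 (by positivity)
      _ = (a * (k * b) ^ 3) ^ 2 := by ring
  have hs4 : Real.sqrt I4 ≤ a * (k * b) ^ 3 := by
    have := Real.sqrt_le_sqrt h4'
    rwa [Real.sqrt_sq (by positivity)] at this
  -- assemble
  have hk1 : k ^ 3 ≤ (k + 1) ^ 3 := pow_le_pow_left₀ hk0 (by linarith) 3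
  calc I3 ≤ Real.sqrt A * Real.sqrt I4 := h3
    _ ≤ a ^ 2 * (a * (k * b) ^ 3) := by
        rw [hsA]; exact mul_le_mul_of_nonneg_left hs4 (by positivity)
    _ = k ^ 3 * a ^ 3 * b ^ 3 := by ring
    _ ≤ (k + 1) ^ 3 * a ^ 3 * b ^ 3 := by gcongr
    _ = (Real.sqrt K + 1) ^ 3 * A ^ (3 / 4 : ℝ) * B ^ (3 / 4 : ℝ) := by rw [hA34, hB34]

/-- **Step 2 — display (8) p.7 is a THEOREM** (Gagliardo–Nirenberg on `ℝ³`): with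
`C = √K + 1`, `K` Mathlib's Gagliardo–Nirenberg–Sobolev constant `SNormLESNormFDerivOfEqConst` (`n = 3`,
`p = 2`, `p* = 6`), every smooth rapidly decaying `v : ℝ³ → ℝ³` satisfies
`∫‖v‖³ ≤ C³ (∫‖v‖²)^{3/4} (∫‖Dv‖²)^{3/4}`, i.e. `‖v‖_{L³} ≤ C‖v‖_{L²}^{1/2}‖∇v‖_{L²}^{1/2}`.
Kernel certificate of a step UPSTREAM of the locator of #90 (no verdict/locator/class touched).
[cite: Nwankpa2025, (8) p.7] -/
theorem step2_GN_holds : Step2_GN := by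
  refine ⟨Real.sqrt (SNormLESNormFDerivOfEqConst E3 (volume : Measure E3) 2 : ℝ) + 1,
    by positivity, fun v hv hd => ?_⟩
  have hvc : Continuous v := hv.continuous
  have hv1 : ContDiff ℝ 1 v := hv.of_le (by exact_mod_cast le_top)
  have h4 := integral_norm_pow_add_le hvc hd 1 3 le_rfl (by norm_num)
  have h3 := integral_norm_pow_add_le hvc hd 1 2 le_rfl (by norm_num)
  norm_num at h4 h3
  have h6 := integral_norm_pow_six_le_of_decay hv1 hd
  exact gn_count (integral_nonneg fun x => by positivity) (integral_nonneg fun x => by positivity)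
    (NNReal.coe_nonneg _) h4 h3 h6

/-- `Step2_GN` — `_holds` alias of `step2_GN_holds` above under the fact's exact name (appended
2026-08-28, D-0026 bookkeeping: the proof term is the existing theorem of this file; no statement,
definition or attribute is edited; no new named fact; the ledger's debt table listed the fact
unproved). [cite: Nwankpa2025, (8) p.7] -/
theorem _root_.Literature.Claims.NS.Nwankpa2025.Step2_GN_holds : Step2_GN :=
  _root_.Literature.Claims.NS.Nwankpa2025.step2_GN_holds

end Step2Certificate

end Literature.Claims.NS.Nwankpa2025
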